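import Literature.Analysis.FluidPDE.TaoAveragedComplexAverage
import Literature.Analysis.FluidPDE.TaoAveragedConjugation
import Literature.Analysis.FluidPDE.TaoAveragedSlotFourier
import Literature.Analysis.FluidPDE.TaoAveragedSobolevProofs
import HarnessLib

/-!
# Tao's averaged Navier–Stokes blow-up, §3.1: realness of the Euler form and real parts of symbols

T. Tao, *Finite time blowup for an averaged three-dimensional Navier–Stokes equation*,
J. Amer. Math. Soc. **29** (2016), 601–674 = arXiv:1402.0290v3 (held as `paper:arxiv-1402.0290`;
all numbers are those of that text), §1.1 p. 6 (real and complex Fourier multipliers of order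
`0`: "every complex Fourier multiplier `m(D)` of order `0` can be uniquely decomposed as
`m(D) = m₁(D) + i m₂(D)` with `m₁(D), m₂(D)` real"; the reality condition
`m(-ξ) = \overline{m(ξ)}`) and §3.1 p. 15, the "first step: complexification" of the proof of
Theorem 3.2: "we can decompose them as `m_{j,ω,1}(D) + i m_{j,ω,2}(D)` where
`m_{j,ω,1}(D), m_{j,ω,2}(D)` are real (and with the seminorms of `m_{j,ω,1}(D), m_{j,ω,2}(D)`
bounded by a multiple of the corresponding seminorm of `m_{j,ω}(D)`) ... As the left-hand side of
(3.4) is real (as are the inner products on the right-hand side), we may eliminate all the terms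
on the right-hand side involving odd powers of `i` by taking real parts."

This file supplies the two ingredients of that step which are specific to the named fact
`Literature.Analysis.FluidPDE.Tao2016.complexAverage_isAveraged`
(`TaoAveragedComplexAverage.lean`), over the setting of `TaoAveragedSobolev.lean` and the accepted
`TaoAveragedConjugation.lean` (`conj3`, `conjL2`, `fourierFn_conjL2`) and
`TaoAveragedSlotFourier.lean`:

* **Realness.** `IsFourierHermitian u` (`\overline{û(ξ)} = û(-ξ)` a.e.), `IsReal.isFourierHermitian`
  (real fields have Hermitian transforms), `IsFourierHermitian.fourierMultiplier` (symbols with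
  `\overline{m(ξ)} = m(-ξ)` a.e. preserve it), and `eulerForm_im_of_isFourierHermitian`: **the Euler
  form (1.3) `⟨B(x,y), z⟩` is real whenever `x̂, ŷ, ẑ` are Hermitian** — "the inner products on
  the right-hand side are real". The proof conjugates the integrand of (1.3) (`Λ` has real
  coefficients, `conj_Λ`) and reflects `(ξ₁, ξ₂) ↦ (-ξ₁, -ξ₂)` (`Λ` is odd, `Λ_neg_neg`), giving
  `\overline{J} = -J` for the double integral `J`; no integrability is needed.
* **Real parts of symbols.** `reSymbol m = (m + \overline{m(-·)})/2`,
  `imSymbol m = (m - \overline{m(-·)})/(2i)` (both instances of `symbolPart`), with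
  `m = m₁ + i m₂` (`reSymbol_add_I_mul_imSymbol`), the reality conditions (`reSymbol_neg`,
  `imSymbol_neg`), the seminorm bounds `‖m₁‖_k, ‖m₂‖_k ≤ ‖m‖_k` (`symbolSeminorm_reSymbol_le`,
  `symbolSeminorm_imSymbol_le`; the "multiple" is `1`), hence
  `IsComplexSymbol.isRealSymbol_reSymbol/imSymbol`; measurability in a parameter
  (`measurable_symbolPart`); real multiples of real symbols (`scaleSymbol`,
  `IsRealSymbol.scaleSymbol`, for the signs and the normalising constant of §3.1); and the
  decomposition of the operator, `m(D)u = m₁(D)u + i m₂(D)u`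
  (`IsComplexSymbol.fourierMultiplier_eq_re_add_im`), together with the a.e. reality condition of
  the `L^∞` class of a real symbol (`IsRealSymbol.conj_toLp_ae`).

## What is not here

The expansion of (3.4) into `2³` pieces, the concatenation of four copies of `(Ω, μ)` and the
normalisation — i.e. the discharge of `complexAverage_isAveraged` itself — which also needs the
absolute convergence of (1.3) and of (3.4) (Tao, p. 7); these are assembled in a sibling file.

## References

* T. Tao, J. Amer. Math. Soc. 29 (2016), 601–674, arXiv:1402.0290v3, §1.1 p. 6, (1.3)–(1.4),
  §3.1 p. 15. Key `Tao2016AveragedNS`.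
-/

noncomputable section

open MeasureTheory Set Filter FourierTransform
open scoped ENNReal NNReal SchwartzMap ComplexConjugate

namespace Literature.Analysis.FluidPDE.Tao2016

/-- Local notation for physical / frequency space `ℝ³`. -/
local notation "ℝ³" => EuclideanSpace ℝ (Fin 3)
/-- Local notation for the complexified range `ℂ³`. -/
local notation "ℂ³" => EuclideanSpace ℂ (Fin 3)

open FunctionSpaces (eFourierSobolevNorm)
open FunctionSpaces.EuclideanSpace (complexify complexify_apply)

/-! ### Realness on the Fourier side -/

/-- A vector with real components is fixed by conjugation. [folklore] -/
theorem conj3_eq_self_of_im_eq_zero {v : ℂ³} (hv : ∀ i, (v i).im = 0) : conj3 v = v := by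
  ext i
  rw [conj3_apply]
  exact Complex.conj_eq_iff_im.mpr (hv i)

/-- A real field is its own conjugate: `ū = u`. [folklore] -/
theorem IsReal.conjL2_eq {u : L2C} (hu : IsReal u) : conjL2 u = u := by
  apply Lp.ext
  filter_upwards [coeFn_conjL2 u, hu] with x hx hux
  rw [hx, conj3_eq_self_of_im_eq_zero hux]

/-- **Hermitian symmetry on the Fourier side**: `\overline{û(ξ)} = û(-ξ)` for a.e. `ξ`
(componentwise conjugation) — the Fourier-side expression of the realness of a field, and the
condition Tao imposes on real multipliers, `m(-ξ) = \overline{m(ξ)}` (p. 6). [cite: Tao2016AveragedNS, §1.1 p. 6] -/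
def IsFourierHermitian (u : L2C) : Prop :=
  ∀ᵐ ξ ∂(volume : Measure ℝ³), conj3 (fourierFn u ξ) = fourierFn u (-ξ)

/-- **The Fourier transform of a real field is Hermitian**: if `u ∈ L²(ℝ³; ℂ³)` is real then
`\overline{û(ξ)} = û(-ξ)` for a.e. `ξ` (from the accepted `𝓕 ū = \overline{𝓕u(-·)}`,
`fourierFn_conjL2`, and `ū = u`). [folklore] -/
theorem IsReal.isFourierHermitian {u : L2C} (hu : IsReal u) : IsFourierHermitian u := by
  have h := fourierFn_conjL2 u
  rw [hu.conjL2_eq] at h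
  unfold IsFourierHermitian
  filter_upwards [h] with ξ hξ
  rw [hξ, conj3_conj3]

/-- **Real multipliers preserve Hermitian symmetry**: if the symbol obeys the reality condition
`\overline{m(ξ)} = m(-ξ)` a.e. (Tao 2016, p. 6: "then `m(D)` maps `H¹⁰_df` to itself") and `û` is
Hermitian, then so is `\widehat{m(D)u} = m û`. [cite: Tao2016AveragedNS, §1.1 p. 6] -/
theorem IsFourierHermitian.fourierMultiplier {m : Lp ℂ ∞ (volume : Measure ℝ³)}
    (hm : ∀ᵐ ξ ∂(volume : Measure ℝ³), conj ((m : ℝ³ → ℂ) ξ) = (m : ℝ³ → ℂ) (-ξ)) {u : L2C}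
    (hu : IsFourierHermitian u) : IsFourierHermitian (fourierMultiplier m u) := by
  unfold IsFourierHermitian at *
  filter_upwards [fourierFn_fourierMultiplier m u,
    (Measure.measurePreserving_neg (volume : Measure ℝ³)).quasiMeasurePreserving.ae_eq_comp
      (fourierFn_fourierMultiplier m u), hm, hu]
    with ξ h1 h2 h3 h4
  simp only [Function.comp_apply] at h2
  rw [h1, h2, conj3_smul, h3, h4]

/-- Hermitian symmetry is preserved by real scalars. [folklore] -/
theorem IsFourierHermitian.smul {u : L2C} (hu : IsFourierHermitian u) (r : ℝ) :
    IsFourierHermitian ((r : ℂ) • u) := by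
  unfold IsFourierHermitian at *
  filter_upwards [fourierFn_smul (r : ℂ) u,
    (Measure.measurePreserving_neg (volume : Measure ℝ³)).quasiMeasurePreserving.ae_eq_comp
      (fourierFn_smul (r : ℂ) u), hu] with ξ h1 h2 h3
  simp only [Function.comp_apply] at h2
  rw [h1, h2, conj3_smul, Complex.conj_ofReal, h3]

/-! ### Realness of the Euler form on Hermitian fields -/

/-- `conj (a · b) = ā · b̄` for the complex bilinear dot product. [folklore] -/
theorem conj_cdot (a b : ℂ³) : conj (cdot a b) = cdot (conj3 a) (conj3 b) := by
  simp [cdot, map_sum]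

/-- `a · (-b) = -(a · b)`. [folklore] -/
theorem cdot_neg_right (a b : ℂ³) : cdot a (-b) = -cdot a b := by
  simp [cdot, Finset.sum_neg_distrib]

/-- Tao's symbol `Λ` (1.4) has real coefficients: conjugating its three vector arguments
conjugates its value. [cite: Tao2016AveragedNS, (1.4)] -/
theorem conj_Λ (ξ₁ ξ₂ : ℝ³) (X₁ X₂ X₃ : ℂ³) :
    conj (Λ ξ₁ ξ₂ X₁ X₂ X₃) = Λ ξ₁ ξ₂ (conj3 X₁) (conj3 X₂) (conj3 X₃) := by
  simp only [Λ, map_add, map_mul, conj_cdot, conj3_complexify]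

/-- `Λ` is odd in the pair of frequencies: `Λ_{-ξ₁,-ξ₂} = -Λ_{ξ₁,ξ₂}` (each term of (1.4) carries
exactly one frequency). [cite: Tao2016AveragedNS, (1.4)] -/
theorem Λ_neg_neg (ξ₁ ξ₂ : ℝ³) (X₁ X₂ X₃ : ℂ³) :
    Λ (-ξ₁) (-ξ₂) X₁ X₂ X₃ = -Λ ξ₁ ξ₂ X₁ X₂ X₃ := by
  simp only [Λ, map_neg, cdot_neg_right]
  ring

/-- **The Euler form is real on Fourier-Hermitian fields** ("the inner products on the
right-hand side [of (3.4)] are real", Tao 2016, p. 15; here for `⟨B(x,y), z⟩` with `x̂, ŷ, ẑ`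
Hermitian, in particular for real `x, y, z`): conjugating the integrand of (1.3) and changing
variables `(ξ₁, ξ₂) ↦ (-ξ₁, -ξ₂)` shows `\overline{J} = -J` for
`J = ∫∫ Λ(x̂(ξ₁), ŷ(ξ₂), ẑ(-ξ₁-ξ₂))`, so `J` is purely imaginary and `-πi J` is real. No
integrability is needed (conjugation and the reflection commute with the Bochner integral
unconditionally). [cite: Tao2016AveragedNS, §3.1 p. 15] -/
theorem eulerForm_im_of_isFourierHermitian {x y z : L2C} (hx : IsFourierHermitian x)
    (hy : IsFourierHermitian y) (hz : IsFourierHermitian z) : (eulerForm x y z).im = 0 := by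
  set F : ℝ³ × ℝ³ → ℂ := fun p =>
    Λ p.1 p.2 (fourierFn x p.1) (fourierFn y p.2) (fourierFn z (-p.1 - p.2)) with hF
  set J : ℂ := ∫ p, F p with hJ
  -- the conjugate integrand is the reflected integrand, a.e.
  have hae : ∀ᵐ p : ℝ³ × ℝ³ ∂volume, conj (F p) = -F (-p) := by
    have h1 : ∀ᵐ p : ℝ³ × ℝ³ ∂volume, conj3 (fourierFn x p.1) = fourierFn x (-p.1) := by
      rw [Measure.volume_eq_prod]
      exact (Measure.quasiMeasurePreserving_fst (μ := volume) (ν := volume)).ae hx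
    have h2 : ∀ᵐ p : ℝ³ × ℝ³ ∂volume, conj3 (fourierFn y p.2) = fourierFn y (-p.2) := by
      rw [Measure.volume_eq_prod]
      exact (Measure.quasiMeasurePreserving_snd (μ := volume) (ν := volume)).ae hy
    have h3 : ∀ᵐ p : ℝ³ × ℝ³ ∂volume,
        conj3 (fourierFn z (-p.1 - p.2)) = fourierFn z (-(-p.1 - p.2)) := by
      rw [Measure.volume_eq_prod]
      exact ((Measure.quasiMeasurePreserving_snd (μ := volume) (ν := volume)).comp
        (measurePreserving_shear₂₃ (volume : Measure ℝ³)).quasiMeasurePreserving).ae hz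
    filter_upwards [h1, h2, h3] with p e1 e2 e3
    rw [hF]
    dsimp only
    rw [conj_Λ, e1, e2, e3, Prod.fst_neg, Prod.snd_neg, Λ_neg_neg, neg_neg, neg_neg]
    congr 2
    abel
  have hneg : MeasurePreserving (fun p : ℝ³ × ℝ³ => -p) volume volume := by
    have h := (Measure.measurePreserving_neg (volume : Measure ℝ³)).prod
      (Measure.measurePreserving_neg (volume : Measure ℝ³))
    rw [Measure.volume_eq_prod]
    exact h
  have hconj : conj J = -J := by
    rw [hJ, ← integral_conj, integral_congr_ae hae, integral_neg,
      hneg.integral_comp (Homeomorph.neg (ℝ³ × ℝ³)).measurableEmbedding F]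
  have hre : J.re = 0 := by
    have h := congrArg Complex.re hconj
    rw [Complex.conj_re, Complex.neg_re] at h
    linarith
  change (-(Real.pi * Complex.I) * J).im = 0
  simp [hre]

/-! ### Real and imaginary parts of a complex symbol -/

/-- The reflected conjugate `ξ ↦ \overline{m(-ξ)}` of a symbol. [folklore] -/
def reflConj (m : ℝ³ → ℂ) (ξ : ℝ³) : ℂ := conj (m (-ξ))

/-- The **part** `ξ ↦ c (m(ξ) + ε \overline{m(-ξ)})` of a complex symbol; the real part `m₁` is
`(c, ε) = (½, 1)` and the imaginary part `m₂` is `(c, ε) = (-i/2, -1)`, so that `m = m₁ + i m₂`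
("every complex Fourier multiplier `m(D)` of order `0` can be uniquely decomposed as
`m(D) = m₁(D) + i m₂(D)` with `m₁(D), m₂(D)` real Fourier multipliers of order `0`", Tao 2016,
p. 6). [cite: Tao2016AveragedNS, §1.1 p. 6] -/
def symbolPart (c ε : ℂ) (m : ℝ³ → ℂ) (ξ : ℝ³) : ℂ := c * (m ξ + ε * reflConj m ξ)

/-- The **real part** `m₁ = (m + \overline{m(-·)})/2` of a complex symbol (Tao 2016, p. 6 and
§3.1 p. 15: `m_{j,ω} = m_{j,ω,1} + i m_{j,ω,2}`). [cite: Tao2016AveragedNS, §3.1 p. 15] -/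
def reSymbol (m : ℝ³ → ℂ) : ℝ³ → ℂ := symbolPart 2⁻¹ 1 m

/-- The **imaginary part** `m₂ = (m - \overline{m(-·)})/(2i)` of a complex symbol (Tao 2016,
p. 6 and §3.1 p. 15). [cite: Tao2016AveragedNS, §3.1 p. 15] -/
def imSymbol (m : ℝ³ → ℂ) : ℝ³ → ℂ := symbolPart (2⁻¹ * -Complex.I) (-1) m

/-- `m = m₁ + i m₂` pointwise. [cite: Tao2016AveragedNS, §1.1 p. 6] -/
theorem reSymbol_add_I_mul_imSymbol (m : ℝ³ → ℂ) (ξ : ℝ³) :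
    reSymbol m ξ + Complex.I * imSymbol m ξ = m ξ := by
  simp only [reSymbol, imSymbol, symbolPart]
  linear_combination (2⁻¹ * (reflConj m ξ - m ξ)) * Complex.I_mul_I

/-- The real part obeys the reality condition `m₁(-ξ) = \overline{m₁(ξ)}`. [cite: Tao2016AveragedNS, §1.1 p. 6] -/
theorem reSymbol_neg (m : ℝ³ → ℂ) (ξ : ℝ³) : reSymbol m (-ξ) = conj (reSymbol m ξ) := by
  simp only [reSymbol, symbolPart, reflConj, neg_neg, map_mul, map_add, map_inv₀, map_ofNat,
    map_one, Complex.conj_conj]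
  ring

/-- The imaginary part obeys the reality condition `m₂(-ξ) = \overline{m₂(ξ)}`. [cite: Tao2016AveragedNS, §1.1 p. 6] -/
theorem imSymbol_neg (m : ℝ³ → ℂ) (ξ : ℝ³) : imSymbol m (-ξ) = conj (imSymbol m ξ) := by
  simp only [imSymbol, symbolPart, reflConj, neg_neg, map_mul, map_add, map_inv₀, map_ofNat,
    map_neg, map_one, Complex.conj_conj, Complex.conj_I]
  ring

/-- `\overline{m(-·)}` is smooth off the origin when `m` is. [folklore] -/
theorem contDiffOn_reflConj {m : ℝ³ → ℂ}
    (hm : ContDiffOn ℝ ((⊤ : ℕ∞) : WithTop ℕ∞) m {0}ᶜ) :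
    ContDiffOn ℝ ((⊤ : ℕ∞) : WithTop ℕ∞) (reflConj m) {0}ᶜ := by
  have h : reflConj m = Complex.conjCLE ∘ (m ∘ fun ξ : ℝ³ => -ξ) := rfl
  rw [h]
  refine Complex.conjCLE.contDiff.comp_contDiffOn (hm.comp contDiff_neg.contDiffOn ?_)
  intro ξ hξ
  simpa using hξ

/-- A part of a symbol is smooth off the origin when the symbol is. [folklore] -/
theorem contDiffOn_symbolPart (c ε : ℂ) {m : ℝ³ → ℂ}
    (hm : ContDiffOn ℝ ((⊤ : ℕ∞) : WithTop ℕ∞) m {0}ᶜ) :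
    ContDiffOn ℝ ((⊤ : ℕ∞) : WithTop ℕ∞) (symbolPart c ε m) {0}ᶜ := by
  unfold symbolPart
  exact contDiffOn_const.mul (hm.add (contDiffOn_const.mul (contDiffOn_reflConj hm)))

/-- The iterated derivatives of `\overline{m(-·)}` have the norms of those of `m` at `-ξ`
(conjugation and `ξ ↦ -ξ` are linear isometries). [folklore] -/
theorem norm_iteratedFDeriv_reflConj (m : ℝ³ → ℂ) (k : ℕ) (ξ : ℝ³) :
    ‖iteratedFDeriv ℝ k (reflConj m) ξ‖ = ‖iteratedFDeriv ℝ k m (-ξ)‖ := by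
  have h : reflConj m = Complex.conjLIE ∘ (m ∘ (LinearIsometryEquiv.neg ℝ : ℝ³ ≃ₗᵢ[ℝ] ℝ³)) := rfl
  rw [h, LinearIsometryEquiv.norm_iteratedFDeriv_comp_left,
    LinearIsometryEquiv.norm_iteratedFDeriv_comp_right]
  rfl

/-- Pointwise bound for the derivatives of a part: for `‖c‖ ≤ ½`, `‖ε‖ ≤ 1` and `ξ ≠ 0`,
`‖∇ᵏ(symbolPart c ε m)(ξ)‖ ≤ ½ (‖∇ᵏm(ξ)‖ + ‖∇ᵏm(-ξ)‖)`. [folklore] -/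
theorem norm_iteratedFDeriv_symbolPart_le {c ε : ℂ} (hc : ‖c‖ ≤ 2⁻¹) (hε : ‖ε‖ ≤ 1)
    {m : ℝ³ → ℂ} (hm : ContDiffOn ℝ ((⊤ : ℕ∞) : WithTop ℕ∞) m {0}ᶜ) (k : ℕ) {ξ : ℝ³}
    (hξ : ξ ≠ 0) :
    ‖iteratedFDeriv ℝ k (symbolPart c ε m) ξ‖ ≤
      2⁻¹ * (‖iteratedFDeriv ℝ k m ξ‖ + ‖iteratedFDeriv ℝ k m (-ξ)‖) := by
  have hopen : ({0}ᶜ : Set ℝ³) ∈ nhds ξ := isOpen_compl_singleton.mem_nhds hξ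
  have hkle : (k : WithTop ℕ∞) ≤ ((⊤ : ℕ∞) : WithTop ℕ∞) := by exact_mod_cast le_top
  have hmk : ContDiffAt ℝ k m ξ := (hm.contDiffAt hopen).of_le hkle
  have hrk : ContDiffAt ℝ k (reflConj m) ξ :=
    ((contDiffOn_reflConj hm).contDiffAt hopen).of_le hkle
  have hεr : ContDiffAt ℝ k (fun ξ => ε * reflConj m ξ) ξ := contDiffAt_const.mul hrk
  have h1 : symbolPart c ε m = c • (m + fun ξ => ε * reflConj m ξ) := by
    funext η; simp [symbolPart, smul_eq_mul]
  have h2 : (fun ξ => ε * reflConj m ξ) = ε • reflConj m := by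
    funext η; simp [smul_eq_mul]
  have hsum : ContDiffAt ℝ k (m + fun ξ => ε * reflConj m ξ) ξ := hmk.add hεr
  rw [h1, iteratedFDeriv_const_smul_apply hsum, iteratedFDeriv_add_apply hmk hεr, h2,
    iteratedFDeriv_const_smul_apply hrk, norm_smul]
  calc ‖c‖ * ‖iteratedFDeriv ℝ k m ξ + ε • iteratedFDeriv ℝ k (reflConj m) ξ‖
      ≤ 2⁻¹ * (‖iteratedFDeriv ℝ k m ξ‖ + ‖ε • iteratedFDeriv ℝ k (reflConj m) ξ‖) :=
        mul_le_mul hc (norm_add_le _ _) (norm_nonneg _) (by norm_num)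
    _ ≤ 2⁻¹ * (‖iteratedFDeriv ℝ k m ξ‖ + ‖iteratedFDeriv ℝ k m (-ξ)‖) := by
        rw [norm_smul, norm_iteratedFDeriv_reflConj]
        gcongr
        exact mul_le_of_le_one_left (norm_nonneg _) hε

/-- **The seminorms of a part are bounded by those of the symbol**: `‖symbolPart c ε m‖_k ≤ ‖m‖_k`
for `‖c‖ ≤ ½`, `‖ε‖ ≤ 1` ("with the seminorms of `m_{j,ω,1}(D), m_{j,ω,2}(D)` bounded by a multiple
of the corresponding seminorm of `m_{j,ω}(D)`", Tao 2016, p. 15; the multiple is `1`). [cite: Tao2016AveragedNS, §3.1 p. 15] -/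
theorem symbolSeminorm_symbolPart_le {c ε : ℂ} (hc : ‖c‖ ≤ 2⁻¹) (hε : ‖ε‖ ≤ 1) {m : ℝ³ → ℂ}
    (hm : ContDiffOn ℝ ((⊤ : ℕ∞) : WithTop ℕ∞) m {0}ᶜ) (k : ℕ) :
    symbolSeminorm k (symbolPart c ε m) ≤ symbolSeminorm k m := by
  set T := symbolSeminorm k m with hT
  refine iSup₂_le fun ξ hξ => ?_
  have hξ' : ξ ≠ 0 := hξ
  have hb1 : (‖ξ‖₊ : ℝ≥0∞) ^ k * ‖iteratedFDeriv ℝ k m ξ‖₊ ≤ T :=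
    le_iSup₂ (f := fun (ξ : ℝ³) (_ : ξ ∈ ({0}ᶜ : Set ℝ³)) =>
      (‖ξ‖₊ : ℝ≥0∞) ^ k * (‖iteratedFDeriv ℝ k m ξ‖₊ : ℝ≥0∞)) ξ hξ
  have hb2 : (‖ξ‖₊ : ℝ≥0∞) ^ k * ‖iteratedFDeriv ℝ k m (-ξ)‖₊ ≤ T := by
    have h := le_iSup₂ (f := fun (ξ : ℝ³) (_ : ξ ∈ ({0}ᶜ : Set ℝ³)) =>
      (‖ξ‖₊ : ℝ≥0∞) ^ k * (‖iteratedFDeriv ℝ k m ξ‖₊ : ℝ≥0∞)) (-ξ)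
      (show -ξ ∈ ({0}ᶜ : Set ℝ³) from neg_ne_zero.mpr hξ')
    rwa [nnnorm_neg] at h
  have key : (‖iteratedFDeriv ℝ k (symbolPart c ε m) ξ‖₊ : ℝ≥0∞) ≤
      2⁻¹ * ((‖iteratedFDeriv ℝ k m ξ‖₊ : ℝ≥0∞) + ‖iteratedFDeriv ℝ k m (-ξ)‖₊) := by
    have h := norm_iteratedFDeriv_symbolPart_le hc hε hm k hξ'
    have h' : (‖iteratedFDeriv ℝ k (symbolPart c ε m) ξ‖₊ : ℝ≥0∞) ≤
        ENNReal.ofReal (2⁻¹ * (‖iteratedFDeriv ℝ k m ξ‖ + ‖iteratedFDeriv ℝ k m (-ξ)‖)) := by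
      rw [← enorm_eq_nnnorm, ← ofReal_norm]
      exact ENNReal.ofReal_le_ofReal h
    refine h'.trans_eq ?_
    rw [ENNReal.ofReal_mul (by norm_num), ENNReal.ofReal_add (norm_nonneg _) (norm_nonneg _),
      ofReal_norm, ofReal_norm, enorm_eq_nnnorm, enorm_eq_nnnorm, ENNReal.ofReal_inv_of_pos
      two_pos, ENNReal.ofReal_ofNat]
  calc (‖ξ‖₊ : ℝ≥0∞) ^ k * ‖iteratedFDeriv ℝ k (symbolPart c ε m) ξ‖₊
      ≤ (‖ξ‖₊ : ℝ≥0∞) ^ k *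
          (2⁻¹ * ((‖iteratedFDeriv ℝ k m ξ‖₊ : ℝ≥0∞) + ‖iteratedFDeriv ℝ k m (-ξ)‖₊)) := by
        gcongr
    _ = 2⁻¹ * ((‖ξ‖₊ : ℝ≥0∞) ^ k * ‖iteratedFDeriv ℝ k m ξ‖₊ +
          (‖ξ‖₊ : ℝ≥0∞) ^ k * ‖iteratedFDeriv ℝ k m (-ξ)‖₊) := by ring
    _ ≤ 2⁻¹ * (T + T) := by gcongr
    _ = T := by
        rw [← two_mul, ← mul_assoc, ENNReal.inv_mul_cancel two_ne_zero ENNReal.ofNat_ne_top,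
          one_mul]

/-- A part of a complex order-`0` symbol obeying the reality condition is a real order-`0`
symbol. [cite: Tao2016AveragedNS, §1.1 p. 6] -/
theorem IsComplexSymbol.isRealSymbol_symbolPart {c ε : ℂ} (hc : ‖c‖ ≤ 2⁻¹) (hε : ‖ε‖ ≤ 1)
    {m : ℝ³ → ℂ} (hm : IsComplexSymbol m)
    (hreal : ∀ ξ, ξ ≠ 0 → symbolPart c ε m (-ξ) = conj (symbolPart c ε m ξ)) :
    IsRealSymbol (symbolPart c ε m) :=
  ⟨contDiffOn_symbolPart c ε hm.1,
    fun k => lt_of_le_of_lt (symbolSeminorm_symbolPart_le hc hε hm.1 k) (hm.2 k), hreal⟩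

/-- **The real part of a complex order-`0` symbol is a real order-`0` symbol** (Tao 2016, p. 6). [cite: Tao2016AveragedNS, §1.1 p. 6] -/
theorem IsComplexSymbol.isRealSymbol_reSymbol {m : ℝ³ → ℂ} (hm : IsComplexSymbol m) :
    IsRealSymbol (reSymbol m) :=
  hm.isRealSymbol_symbolPart (by norm_num) (by norm_num) fun ξ _ => reSymbol_neg m ξ

/-- **The imaginary part of a complex order-`0` symbol is a real order-`0` symbol** (Tao 2016,
p. 6). [cite: Tao2016AveragedNS, §1.1 p. 6] -/
theorem IsComplexSymbol.isRealSymbol_imSymbol {m : ℝ³ → ℂ} (hm : IsComplexSymbol m) :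
    IsRealSymbol (imSymbol m) :=
  hm.isRealSymbol_symbolPart (by norm_num) (by norm_num) fun ξ _ => imSymbol_neg m ξ

/-- Seminorms of the real part: `‖m₁‖_k ≤ ‖m‖_k`. [cite: Tao2016AveragedNS, §3.1 p. 15] -/
theorem symbolSeminorm_reSymbol_le {m : ℝ³ → ℂ} (hm : IsComplexSymbol m) (k : ℕ) :
    symbolSeminorm k (reSymbol m) ≤ symbolSeminorm k m :=
  symbolSeminorm_symbolPart_le (by norm_num) (by norm_num) hm.1 k

/-- Seminorms of the imaginary part: `‖m₂‖_k ≤ ‖m‖_k`. [cite: Tao2016AveragedNS, §3.1 p. 15] -/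
theorem symbolSeminorm_imSymbol_le {m : ℝ³ → ℂ} (hm : IsComplexSymbol m) (k : ℕ) :
    symbolSeminorm k (imSymbol m) ≤ symbolSeminorm k m :=
  symbolSeminorm_symbolPart_le (by norm_num) (by norm_num) hm.1 k

/-- Measurability of a part in a parameter: if `θ ↦ m θ ξ` is measurable for every `ξ ≠ 0`, so
is `θ ↦ symbolPart c ε (m θ) ξ`. [folklore] -/
theorem measurable_symbolPart {Ω : Type*} [MeasurableSpace Ω] (c ε : ℂ) {m : Ω → ℝ³ → ℂ}
    (hm : ∀ ξ, ξ ≠ 0 → Measurable fun θ => m θ ξ) {ξ : ℝ³} (hξ : ξ ≠ 0) :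
    Measurable fun θ => symbolPart c ε (m θ) ξ := by
  unfold symbolPart reflConj
  exact ((hm ξ hξ).add ((Complex.continuous_conj.measurable.comp
    (hm (-ξ) (neg_ne_zero.mpr hξ))).const_mul ε)).const_mul c

/-! ### Real multiples of real symbols (signs and normalising constants, §3.1) -/

/-- A real constant multiple of a symbol. [cite: Tao2016AveragedNS, §3.1 p. 15] -/
def scaleSymbol (r : ℝ) (m : ℝ³ → ℂ) (ξ : ℝ³) : ℂ := (r : ℂ) * m ξ

/-- Seminorms scale: `‖r m‖_k ≤ ‖r‖ ‖m‖_k`. [folklore] -/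
theorem symbolSeminorm_scaleSymbol_le (r : ℝ) {m : ℝ³ → ℂ}
    (hm : ContDiffOn ℝ ((⊤ : ℕ∞) : WithTop ℕ∞) m {0}ᶜ) (k : ℕ) :
    symbolSeminorm k (scaleSymbol r m) ≤ ‖(r : ℂ)‖ₑ * symbolSeminorm k m := by
  unfold symbolSeminorm
  rw [ENNReal.mul_iSup]
  refine iSup_mono fun ξ => ?_
  rw [ENNReal.mul_iSup]
  refine iSup_mono fun hξ => ?_
  have hξ' : ξ ≠ 0 := hξ
  have hkle : (k : WithTop ℕ∞) ≤ ((⊤ : ℕ∞) : WithTop ℕ∞) := by exact_mod_cast le_top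
  have hmk : ContDiffAt ℝ k m ξ :=
    (hm.contDiffAt (isOpen_compl_singleton.mem_nhds hξ')).of_le hkle
  have h1 : scaleSymbol r m = (r : ℂ) • m := by
    funext η; simp [scaleSymbol, smul_eq_mul]
  rw [h1, iteratedFDeriv_const_smul_apply hmk, nnnorm_smul, ENNReal.coe_mul, ← enorm_eq_nnnorm (r : ℂ)]
  ring_nf
  exact le_rfl

/-- **A real multiple of a real order-`0` symbol is a real order-`0` symbol** (used to absorb the
signs `±1` and the normalising constant into `m_{1,ω}`, Tao 2016, §3.1 p. 15). [cite: Tao2016AveragedNS, §3.1 p. 15] -/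
theorem IsRealSymbol.scaleSymbol {m : ℝ³ → ℂ} (hm : IsRealSymbol m) (r : ℝ) :
    IsRealSymbol (scaleSymbol r m) := by
  refine ⟨contDiffOn_const.mul hm.1, fun k => ?_, fun ξ hξ => ?_⟩
  · exact lt_of_le_of_lt (symbolSeminorm_scaleSymbol_le r hm.1 k)
      (ENNReal.mul_lt_top enorm_lt_top (hm.2.1 k))
  · change (r : ℂ) * m (-ξ) = conj ((r : ℂ) * m ξ)
    rw [hm.2.2 ξ hξ, map_mul, Complex.conj_ofReal]

/-! ### Decomposition of the multiplier: `m(D) = m₁(D) + i m₂(D)` -/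

/-- Fourier multipliers are additive in the symbol. [folklore] -/
theorem fourierMultiplier_symbol_add (m₁ m₂ : Lp ℂ ∞ (volume : Measure ℝ³)) (u : L2C) :
    fourierMultiplier (m₁ + m₂) u = fourierMultiplier m₁ u + fourierMultiplier m₂ u := by
  unfold fourierMultiplier
  rw [Lp.smul_add, FourierTransform.fourierInv_add]

/-- Fourier multipliers are homogeneous in the symbol. [folklore] -/
theorem fourierMultiplier_symbol_smul (a : ℂ) (m : Lp ℂ ∞ (volume : Measure ℝ³)) (u : L2C) :
    fourierMultiplier (a • m) u = a • fourierMultiplier m u := by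
  unfold fourierMultiplier
  rw [Lp.smul_assoc, FourierTransform.fourierInv_smul]

/-- The `L^∞` class of a complex symbol splits as `m = m₁ + i m₂`. [cite: Tao2016AveragedNS, §1.1 p. 6] -/
theorem IsComplexSymbol.toLp_eq_reSymbol_add_imSymbol {m : ℝ³ → ℂ} (hm : IsComplexSymbol m) :
    hm.memLp_top.toLp m = hm.isRealSymbol_reSymbol.memLp_top.toLp (reSymbol m) +
      Complex.I • hm.isRealSymbol_imSymbol.memLp_top.toLp (imSymbol m) := by
  rw [← MemLp.toLp_const_smul, ← MemLp.toLp_add]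
  refine MemLp.toLp_congr _ _ (Eventually.of_forall fun ξ => ?_)
  simp only [Pi.add_apply, Pi.smul_apply, smul_eq_mul]
  exact (reSymbol_add_I_mul_imSymbol m ξ).symm

/-- **`m(D) u = m₁(D) u + i m₂(D) u`**: the multiplier of a complex order-`0` symbol splits into
the multipliers of its real and imaginary parts (Tao 2016, p. 6 and §3.1 p. 15). [cite: Tao2016AveragedNS, §3.1 p. 15] -/
theorem IsComplexSymbol.fourierMultiplier_eq_re_add_im {m : ℝ³ → ℂ} (hm : IsComplexSymbol m)
    (u : L2C) :
    fourierMultiplier (hm.memLp_top.toLp m) u =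
      fourierMultiplier (hm.isRealSymbol_reSymbol.memLp_top.toLp (reSymbol m)) u +
        Complex.I • fourierMultiplier (hm.isRealSymbol_imSymbol.memLp_top.toLp (imSymbol m)) u := by
  rw [hm.toLp_eq_reSymbol_add_imSymbol, fourierMultiplier_symbol_add, fourierMultiplier_symbol_smul]

/-- The `L^∞` class of a scaled symbol is the scaled class. [folklore] -/
theorem toLp_scaleSymbol {m : ℝ³ → ℂ} (hm : MemLp m ∞ (volume : Measure ℝ³)) (r : ℝ)
    (hrm : MemLp (scaleSymbol r m) ∞ (volume : Measure ℝ³)) :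
    hrm.toLp (scaleSymbol r m) = (r : ℂ) • hm.toLp m := by
  rw [← MemLp.toLp_const_smul]
  rfl

/-- **The reality condition at the level of `L^∞` classes**: for a real order-`0` symbol,
`\overline{m(ξ)} = m(-ξ)` for a.e. `ξ` (the representative of the class agrees with `m` a.e.,
and `{0}` is null). [cite: Tao2016AveragedNS, §1.1 p. 6] -/
theorem IsRealSymbol.conj_toLp_ae {m : ℝ³ → ℂ} (hm : IsRealSymbol m) :
    ∀ᵐ ξ ∂(volume : Measure ℝ³), conj ((hm.memLp_top.toLp m : ℝ³ → ℂ) ξ) =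
      (hm.memLp_top.toLp m : ℝ³ → ℂ) (-ξ) := by
  have h0 : ({0}ᶜ : Set ℝ³) ∈ ae (volume : Measure ℝ³) :=
    compl_mem_ae_iff.mpr (measure_singleton _)
  filter_upwards [MemLp.coeFn_toLp hm.memLp_top,
    (Measure.measurePreserving_neg (volume : Measure ℝ³)).quasiMeasurePreserving.ae_eq
      (MemLp.coeFn_toLp hm.memLp_top), h0] with ξ h1 h2 h3
  simp only [Function.comp_apply] at h2
  rw [h1, h2, hm.2.2 ξ h3]

end Literature.Analysis.FluidPDE.Tao2016
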